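import Literature.Computability.QuantumComplexity.PauliPathOrthogonality
import HarnessLib

/-!
# Out-of-time-order correlators: the scored quantity of the scrambling / "quantum echoes" claims,
  its echo-sequence form, the light-cone plateau, and the `±1` values of Clifford instances

Topic `Literature/Computability/QuantumComplexity` (pub-qadeq lane, CLAIMS rows E-05 / E-22: Google's
65-qubit `OTOC⁽²⁾` measurements "∼13,000× Frontier", and the earlier Sycamore scrambling experiment;
the typed quantity also underlies S-8's "≤ 40-qubit exact checks").

HONEST FRAMING: instance-level adjudication of specific advantage claims; no claim about BQP vs BPP
or the summit. This file only TYPES the correlators as printed and proves the elementary algebraic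
identities the primaries state about them (echo form, commuting plateau, Clifford instances, commutator
form); nothing here concerns the classical cost of any circuit family.

## Sources (verbatim)

[MiEtAl2021] X. Mi, P. Roushan, C. Quintana, …, Y. Chen (Google), *Information scrambling in quantum
circuits*, Science 374, 1479 (2021) = arXiv:2101.08870 (pp. 2 and 5 of the arXiv PDF): "Our experiment
approach is based on evaluating the correlator between `Ô(t)` and a "measurement operator", `M̂`, which
is another Pauli operator on a different qubit (the "measurement qubit"): `C(t) = ⟨Ô†(t) M̂† Ô(t) M̂⟩` (1).
Here `⟨…⟩` denotes the expectation value over a particular quantum state. `C(t)` is commonly known as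
the out-of-time-order correlator (OTOC) and related to the commutator `[Ô(t), M̂]` by
`C(t) = 1 − ½⟨|[Ô(t), M̂]|²⟩`" (p. 2); "At `N_D = 0` where the circuits consist of only Clifford gates,
we see that `C` takes discrete values of `1` or `−1`. This is expected as the time-evolved butterfly
operator `Ô(t)` is a single Pauli string and therefore either commutes or anti-commutes with the
measurement operator `M̂`." (p. 5).

[GoogleQuantumAI2025OTOC] Google Quantum AI and Collaborators, *Observation of constructive interference
at the edge of quantum ergodicity*, Nature 646, 825 (2025) = arXiv:2506.10191 (p. 2): "the dynamics `U`
is replaced with the nested echo sequence `U_k(t) = B(t)[M B(t)]^{k−1}`, where `B(t) = U†(t) B U(t)` is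
the time-evolved operator of another Pauli `B` acting on qubit(s) `q_b` some distance away from `q_m`,
and `k ≥ 1` is an integer. … Since `U_k†(t) = U_k(t)`, the expectation value (denoted as `C⁽²ᵏ⁾` in
this case) may be written as: `C⁽²ᵏ⁾ = ⟨U_k†(t) M U_k(t) M⟩ = ⟨(B(t)M)^{2k}⟩` (1). The quantity `C⁽²⁾`
coincides with the well-known out-of-time-order correlator, OTOC. We therefore refer to `C⁽²ᵏ⁾` as
OTOC⁽ᵏ⁾ or kth-order OTOC. Eqn. 1 yields two key insights: First, if the information originating from
`q_m` has not yet reached `q_b`, `B(t)` commutes with `M` and the information coming back to `q_m` is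
identical to its initial value. … Second, provided `U` is not a Clifford sequence, information starting
from `M` and returning to `M` can take multiple different paths in configuration space."

## Contents (all proved, 0 named facts)

General part, on `Matrix m m ℂ` for any finite index type `m` (a state is any matrix `ρ`, expectation
`⟨A⟩ = Tr(ρA)`):
* `heis U B = Uᴴ B U` (`B(t)`), `echo k U B M = B(t)(M B(t))^{k−1}` (`U_k`),
  `corr k ρ U B M = Tr(ρ · U_kᴴ M U_k M)` (`C⁽²ᵏ⁾`); `corr_one` (`C⁽²⁾ = ⟨B(t)ᴴ M B(t) M⟩`, Mi et al.'s
  eq. (1) with Hermitian `M`).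
* `conjTranspose_echo` ("since `U_k† = U_k`", for Hermitian `B`, `M`), `echo_mul`
  (`U_k M = (B(t)M)^k`) and **eq. (1)** `corr_eq_trace_pow`: `C⁽²ᵏ⁾ = Tr(ρ (B(t)M)^{2k})`.
* **The plateau before the light cone** `corr_eq_trace_of_commute`: if `B(t)` commutes with `M` and both
  square to `1` (Paulis), `C⁽²ᵏ⁾ = Tr ρ` ("identical to its initial value"); `heis_mul_heis` (unitary
  conjugation preserves products, so `B(t)² = 1` when `B² = 1`).
* **Commutator form** `two_sub_eq_commutator` / `re_corr_one_eq`: for unitary `B(t)`, `M` and Hermitian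
  `ρ`, `Re C⁽²⁾ = Re Tr ρ − ½ Re Tr(ρ [B(t),M]ᴴ[B(t),M])` — Mi et al.'s `C(t) = 1 − ½⟨|[Ô(t),M̂]|²⟩`
  for real `C` and `Tr ρ = 1`.

Pauli part, on the tree's register `ι → Bool` and `pauliString` (`PauliExpansion.lean`,
`PauliPathOrthogonality.lean`'s `strSign`):
* `pauliString_mul_comm_smul` (`S T = κ(S,T) • T S` with `κ = strSign S T`), `strSign_comm`,
  `strSign_mul_self` / `strSign_eq_one_or` (`κ = ±1`), `sq_pauliString_mul` (`(S T)² = κ • 1`).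
* **Clifford instances** `corr_of_heis_eq_smul_pauliString`: if the evolved butterfly is a single signed
  Pauli string, `B(t) = c • S` with `c² = 1`, and `M = T`, then `C⁽²ᵏ⁾ = κ(S,T)^k · Tr ρ`; hence
  `corr_one_…` (`C⁽²⁾ = ± Tr ρ` — "takes discrete values of 1 or −1") and `corr_two_…`
  (`OTOC⁽²⁾ = C⁽⁴⁾ = Tr ρ`, the reason the 2025 experiment needs non-Clifford `U`).

Not formalised: that Clifford `U` maps Pauli strings to signed Pauli strings (the tree's stabilizer
files have it in their own vocabulary; here it is the HYPOTHESIS `heis U B = c • pauliString S`), any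
average over circuit ensembles, off-diagonal `C⁽⁴⁾` components, and all classical-cost statements.
-/

noncomputable section

open Matrix

namespace Literature.Computability.QuantumComplexity

namespace OTOC

section General

variable {m : Type*} [Fintype m] [DecidableEq m]

/-- The Heisenberg-evolved ("time-evolved") operator `B(t) = U† B U`.
[cite: GoogleQuantumAI2025OTOC, p. 2 ("B(t) = U†(t) B U(t)")] -/
def heis (U B : Matrix m m ℂ) : Matrix m m ℂ :=
  Uᴴ * B * U

omit [DecidableEq m] in
/-- `B(t)ᴴ = (Bᴴ)(t)`. [cite: GoogleQuantumAI2025OTOC, p. 2] -/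
theorem conjTranspose_heis (U B : Matrix m m ℂ) : (heis U B)ᴴ = heis U Bᴴ := by
  simp only [heis, conjTranspose_mul, conjTranspose_conjTranspose, Matrix.mul_assoc]

/-- Unitary conjugation is multiplicative: `B(t) B'(t) = (BB')(t)` when `U Uᴴ = 1`; in particular
`B(t)² = 1` for a Pauli `B`. [cite: MiEtAl2021, p. 2 (Ô(t) = Û†ÔÛ)] -/
theorem heis_mul_heis {U : Matrix m m ℂ} (hU : U * Uᴴ = 1) (B B' : Matrix m m ℂ) :
    heis U B * heis U B' = heis U (B * B') := by
  simp only [heis, Matrix.mul_assoc]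
  rw [← Matrix.mul_assoc U Uᴴ, hU, Matrix.one_mul]

/-- The nested echo sequence `U_k = B(t) (M B(t))^{k−1}` (`k ≥ 1`).
[cite: GoogleQuantumAI2025OTOC, p. 2 ("U_k(t) = B(t)[M B(t)]^{k−1}")] -/
def echo (k : ℕ) (U B M : Matrix m m ℂ) : Matrix m m ℂ :=
  heis U B * (M * heis U B) ^ (k - 1)

/-- The `k`th-order correlator `C⁽²ᵏ⁾ = ⟨U_kᴴ M U_k M⟩_ρ = Tr(ρ · U_kᴴ M U_k M)`; `C⁽²⁾` is the OTOC,
`C⁽⁴⁾` is `OTOC⁽²⁾`. [cite: GoogleQuantumAI2025OTOC, eq. (1)] [cite: MiEtAl2021, eq. (1)] -/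
def corr (k : ℕ) (ρ U B M : Matrix m m ℂ) : ℂ :=
  (ρ * ((echo k U B M)ᴴ * M * echo k U B M * M)).trace

/-- `U_1 = B(t)`. [cite: GoogleQuantumAI2025OTOC, p. 2] -/
theorem echo_one (U B M : Matrix m m ℂ) : echo 1 U B M = heis U B := by
  simp [echo]

/-- **Mi et al.'s eq. (1)**: `C⁽²⁾ = ⟨B(t)ᴴ M B(t) M⟩` (for a Pauli `M = Mᴴ` this is the printed
`⟨Ô†(t) M̂† Ô(t) M̂⟩`). [cite: MiEtAl2021, eq. (1)] -/
theorem corr_one (ρ U B M : Matrix m m ℂ) :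
    corr 1 ρ U B M = (ρ * ((heis U B)ᴴ * M * heis U B * M)).trace := by
  rw [corr, echo_one]

/-- Semiconjugation of powers: `(XY)^j X = X (YX)^j`. [folklore] -/
private theorem pow_mul_semiconj (X Y : Matrix m m ℂ) (j : ℕ) :
    (X * Y) ^ j * X = X * (Y * X) ^ j := by
  induction j with
  | zero => simp
  | succ j ih =>
      calc (X * Y) ^ (j + 1) * X = (X * Y) ^ j * X * (Y * X) := by
            rw [pow_succ]; simp only [Matrix.mul_assoc]
        _ = X * (Y * X) ^ (j + 1) := by rw [ih, pow_succ, Matrix.mul_assoc]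

/-- **"Since `U_k† = U_k`"**: the echo sequence is a palindrome, hence Hermitian when `B` and `M` are.
[cite: GoogleQuantumAI2025OTOC, p. 2] -/
theorem conjTranspose_echo {B M : Matrix m m ℂ} (hB : Bᴴ = B) (hM : Mᴴ = M) (k : ℕ) (U : Matrix m m ℂ) :
    (echo k U B M)ᴴ = echo k U B M := by
  rw [echo, conjTranspose_mul, conjTranspose_pow, conjTranspose_mul, conjTranspose_heis, hB, hM]
  exact pow_mul_semiconj _ _ _

/-- `U_k M = (B(t) M)^k` for `k ≥ 1`. [cite: GoogleQuantumAI2025OTOC, eq. (1)] -/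
theorem echo_mul {k : ℕ} (hk : 1 ≤ k) (U B M : Matrix m m ℂ) :
    echo k U B M * M = (heis U B * M) ^ k := by
  obtain ⟨j, rfl⟩ : ∃ j, k = j + 1 := ⟨k - 1, by omega⟩
  rw [echo, Nat.add_sub_cancel, Matrix.mul_assoc, pow_mul_semiconj, ← Matrix.mul_assoc, pow_succ']

/-- **Eq. (1)**: `C⁽²ᵏ⁾ = ⟨U_kᴴ M U_k M⟩ = ⟨(B(t) M)^{2k}⟩` for Hermitian `B`, `M` and `k ≥ 1`.
[cite: GoogleQuantumAI2025OTOC, eq. (1) ("C⁽²ᵏ⁾ = ⟨U_k†(t) M U_k(t) M⟩ = ⟨(B(t)M)^{2k}⟩")] -/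
theorem corr_eq_trace_pow {B M : Matrix m m ℂ} (hB : Bᴴ = B) (hM : Mᴴ = M) {k : ℕ} (hk : 1 ≤ k)
    (ρ U : Matrix m m ℂ) : corr k ρ U B M = (ρ * (heis U B * M) ^ (2 * k)).trace := by
  rw [corr, conjTranspose_echo hB hM,
    show echo k U B M * M * echo k U B M * M = (echo k U B M * M) * (echo k U B M * M) by
      simp only [Matrix.mul_assoc],
    echo_mul hk, ← pow_add, two_mul]

/-- **The plateau before the light cone**: if `B(t)` commutes with `M` and both are involutions
(`B(t)² = M² = 1`, as for Paulis), then `(B(t)M)² = 1` and `C⁽²ᵏ⁾ = Tr ρ` — "if the information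
originating from `q_m` has not yet reached `q_b`, `B(t)` commutes with `M` and the information coming
back to `q_m` is identical to its initial value". [cite: GoogleQuantumAI2025OTOC, p. 2 (first insight after eq. (1))] -/
theorem corr_eq_trace_of_commute {B M : Matrix m m ℂ} (hB : Bᴴ = B) (hM : Mᴴ = M) {k : ℕ} (hk : 1 ≤ k)
    {ρ U : Matrix m m ℂ} (hcomm : heis U B * M = M * heis U B) (hBt : heis U B * heis U B = 1)
    (hM2 : M * M = 1) : corr k ρ U B M = ρ.trace := by
  have hsq : (heis U B * M) ^ 2 = 1 := by
    calc (heis U B * M) ^ 2 = heis U B * (M * heis U B) * M := by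
          rw [sq]; simp only [Matrix.mul_assoc]
      _ = heis U B * (heis U B * M) * M := by rw [← hcomm]
      _ = (heis U B * heis U B) * (M * M) := by simp only [Matrix.mul_assoc]
      _ = 1 := by rw [hBt, hM2, Matrix.mul_one]
  rw [corr_eq_trace_pow hB hM hk, pow_mul, hsq, one_pow, Matrix.mul_one]

/-- The commutator identity behind Mi et al.'s second form: for unitary `O`, `M`,
`[O,M]ᴴ [O,M] = 2·1 − OᴴMᴴOM − (OᴴMᴴOM)ᴴ`. [cite: MiEtAl2021, p. 2 ("related to the commutator … by C(t) = 1 − ½⟨|[Ô(t), M̂]|²⟩")] -/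
theorem commutator_conjTranspose_mul {O M : Matrix m m ℂ} (hO : Oᴴ * O = 1) (hM : Mᴴ * M = 1) :
    (O * M - M * O)ᴴ * (O * M - M * O) =
      2 - Oᴴ * Mᴴ * O * M - (Oᴴ * Mᴴ * O * M)ᴴ := by
  have h1 : Mᴴ * Oᴴ * (O * M) = 1 := by
    rw [Matrix.mul_assoc, ← Matrix.mul_assoc Oᴴ, hO, Matrix.one_mul, hM]
  have h2 : Oᴴ * Mᴴ * (M * O) = 1 := by
    rw [Matrix.mul_assoc, ← Matrix.mul_assoc Mᴴ, hM, Matrix.one_mul, hO]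
  rw [conjTranspose_sub, conjTranspose_mul, conjTranspose_mul, Matrix.sub_mul, Matrix.mul_sub,
    Matrix.mul_sub, h1, h2, ← one_add_one_eq_two]
  simp only [conjTranspose_mul, conjTranspose_conjTranspose, Matrix.mul_assoc]
  abel

/-- **Mi et al.'s commutator form of the OTOC**: for a Hermitian state `ρ`, a unitary evolved
butterfly `O = B(t)` and a Hermitian involution `M` (a Pauli),
`Re C⁽²⁾ = Re Tr ρ − ½ Re Tr(ρ [O,M]ᴴ[O,M])` — i.e. `C(t) = 1 − ½⟨|[Ô(t), M̂]|²⟩` for a normalised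
state and the real part of `C`. [cite: MiEtAl2021, p. 2 ("C(t) = 1 − ½⟨|[Ô(t), M̂]|²⟩")] -/
theorem re_corr_one_eq {ρ U B M : Matrix m m ℂ} (hρ : ρᴴ = ρ) (hO : (heis U B)ᴴ * heis U B = 1)
    (hM : Mᴴ = M) (hM2 : M * M = 1) :
    (corr 1 ρ U B M).re = ρ.trace.re -
      (ρ * ((heis U B * M - M * heis U B)ᴴ * (heis U B * M - M * heis U B))).trace.re / 2 := by
  have hMu : Mᴴ * M = 1 := by rw [hM, hM2]
  have hcomm := commutator_conjTranspose_mul hO hMu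
  rw [hM] at hcomm
  have hstar : (ρ * ((heis U B)ᴴ * M * heis U B * M)ᴴ).trace =
      star ((ρ * ((heis U B)ᴴ * M * heis U B * M)).trace) := by
    rw [← trace_conjTranspose, conjTranspose_mul ρ, hρ, Matrix.trace_mul_comm]
  rw [corr_one, hcomm, Matrix.mul_sub, Matrix.mul_sub, trace_sub, trace_sub, hstar, mul_two, trace_add,
    Complex.sub_re, Complex.sub_re, Complex.add_re, Complex.star_def, Complex.conj_re]
  ring

end General

/-! ### Pauli strings: commutation signs and the values of Clifford instances -/

section PauliStrings

open PauliPath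

variable {ι : Type*} [Fintype ι] [DecidableEq ι]

omit [Fintype ι] [DecidableEq ι] in
/-- The one-qubit conjugation sign is symmetric. [cite: MiEtAl2021, p. 5 ("either commutes or anti-commutes")] -/
theorem sign_comm (Q P : Pauli) : Pauli.sign Q P = Pauli.sign P Q := by
  cases Q <;> cases P <;> simp [Pauli.sign]

omit [Fintype ι] [DecidableEq ι] in
/-- The one-qubit conjugation sign is `±1`. [cite: MiEtAl2021, p. 5] -/
theorem sign_mul_self (Q P : Pauli) : Pauli.sign Q P * Pauli.sign Q P = 1 := by
  unfold Pauli.sign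
  split_ifs <;> norm_num

omit [DecidableEq ι] in
/-- The commutation sign of two Pauli strings is symmetric: `κ(S,T) = κ(T,S)`.
[cite: MiEtAl2021, p. 5 ("either commutes or anti-commutes with the measurement operator")] -/
theorem strSign_comm (S T : ι → Pauli) : strSign S T = strSign T S := by
  simp only [strSign_eq, sign_comm]

omit [DecidableEq ι] in
/-- `κ(S,T)² = 1`. [cite: MiEtAl2021, p. 5] -/
theorem strSign_mul_self (S T : ι → Pauli) : strSign S T * strSign S T = 1 := by
  rw [strSign_eq, ← Finset.prod_mul_distrib]
  exact Finset.prod_eq_one fun i _ => sign_mul_self _ _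

omit [DecidableEq ι] in
/-- `κ(S,T) ∈ {1, −1}`: two Pauli strings either commute or anticommute. [cite: MiEtAl2021, p. 5] -/
theorem strSign_eq_one_or (S T : ι → Pauli) : strSign S T = 1 ∨ strSign S T = -1 :=
  mul_self_eq_one_iff.1 (strSign_mul_self S T)

/-- **Commutation of Pauli strings**: `S T = κ(S,T) • T S`. [cite: MiEtAl2021, p. 5] -/
theorem pauliString_mul_comm_smul (S T : ι → Pauli) :
    pauliString S * pauliString T = strSign S T • (pauliString T * pauliString S) := by
  calc pauliString S * pauliString T
      = pauliString S * pauliString T * (pauliString S * pauliString S) := by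
        rw [pauliString_mul_self, Matrix.mul_one]
    _ = pauliString S * pauliString T * pauliString S * pauliString S := by
        simp only [Matrix.mul_assoc]
    _ = strSign S T • (pauliString T * pauliString S) := by
        rw [pauliString_conj_eq_strSign_smul, Matrix.smul_mul]

/-- `(S T)² = κ(S,T) • 1`. [cite: MiEtAl2021, p. 5] [cite: GoogleQuantumAI2025OTOC, eq. (1)] -/
theorem sq_pauliString_mul (S T : ι → Pauli) :
    (pauliString S * pauliString T) ^ 2 = strSign S T • (1 : Matrix (ι → Bool) (ι → Bool) ℂ) := by
  rw [sq, strSign_comm]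
  calc pauliString S * pauliString T * (pauliString S * pauliString T)
      = pauliString S * (pauliString T * pauliString S * pauliString T) := by
        simp only [Matrix.mul_assoc]
    _ = strSign T S • (1 : Matrix (ι → Bool) (ι → Bool) ℂ) := by
        rw [pauliString_conj_eq_strSign_smul, Matrix.mul_smul, pauliString_mul_self]

/-- **Clifford instances**: if the evolved butterfly operator is a single signed Pauli string,
`B(t) = c • S` with `c² = 1` (as for a Pauli `B` under a Clifford `U`), and the measurement operator is
the Pauli string `T`, then `C⁽²ᵏ⁾ = κ(S,T)^k · Tr ρ` for every `k ≥ 1`.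
[cite: MiEtAl2021, p. 5 ("the time-evolved butterfly operator Ô(t) is a single Pauli string")]
[cite: GoogleQuantumAI2025OTOC, p. 2 ("provided U is not a Clifford sequence …")] -/
theorem corr_of_heis_eq_smul_pauliString {k : ℕ} (hk : 1 ≤ k)
    {ρ U B : Matrix (ι → Bool) (ι → Bool) ℂ} (hB : Bᴴ = B) {c : ℂ} (hc : c * c = 1) {S T : ι → Pauli}
    (hBt : heis U B = c • pauliString S) :
    corr k ρ U B (pauliString T) = strSign S T ^ k * ρ.trace := by
  rw [corr_eq_trace_pow hB (conjTranspose_pauliString T) hk, hBt, pow_mul]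
  have hsq : (c • pauliString S * pauliString T) ^ 2 = strSign S T • (1 : Matrix (ι → Bool) (ι → Bool) ℂ) := by
    rw [Matrix.smul_mul, smul_pow, sq_pauliString_mul, smul_smul, sq, hc, one_mul]
  rw [hsq, smul_pow, one_pow, Matrix.mul_smul, Matrix.mul_one, trace_smul, smul_eq_mul]

/-- **"`C` takes discrete values of `1` or `−1`"**: the OTOC of a Clifford instance is the commutation
sign of the evolved butterfly string with the measurement string, times `Tr ρ`.
[cite: MiEtAl2021, p. 5] -/
theorem corr_one_of_heis_eq_smul_pauliString {ρ U B : Matrix (ι → Bool) (ι → Bool) ℂ} (hB : Bᴴ = B)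
    {c : ℂ} (hc : c * c = 1) {S T : ι → Pauli} (hBt : heis U B = c • pauliString S) :
    corr 1 ρ U B (pauliString T) = strSign S T * ρ.trace := by
  rw [corr_of_heis_eq_smul_pauliString le_rfl hB hc hBt, pow_one]

/-- The dichotomy itself: for a Clifford instance `C⁽²⁾ = Tr ρ` or `C⁽²⁾ = −Tr ρ` (`±1` for a
normalised state). [cite: MiEtAl2021, p. 5 ("C takes discrete values of 1 or −1")] -/
theorem corr_one_eq_trace_or_eq_neg {ρ U B : Matrix (ι → Bool) (ι → Bool) ℂ} (hB : Bᴴ = B)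
    {c : ℂ} (hc : c * c = 1) {S T : ι → Pauli} (hBt : heis U B = c • pauliString S) :
    corr 1 ρ U B (pauliString T) = ρ.trace ∨ corr 1 ρ U B (pauliString T) = -ρ.trace := by
  rw [corr_one_of_heis_eq_smul_pauliString hB hc hBt]
  rcases strSign_eq_one_or S T with h | h <;> simp [h]

/-- **`OTOC⁽²⁾` of a Clifford instance is trivial**: `C⁽⁴⁾ = κ² Tr ρ = Tr ρ` — the second-order
correlator carries no information for Clifford sequences ("provided `U` is not a Clifford sequence,
information … can take multiple different paths"). [cite: GoogleQuantumAI2025OTOC, p. 2 (second insight after eq. (1))] -/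
theorem corr_two_of_heis_eq_smul_pauliString {ρ U B : Matrix (ι → Bool) (ι → Bool) ℂ} (hB : Bᴴ = B)
    {c : ℂ} (hc : c * c = 1) {S T : ι → Pauli} (hBt : heis U B = c • pauliString S) :
    corr 2 ρ U B (pauliString T) = ρ.trace := by
  rw [corr_of_heis_eq_smul_pauliString (by norm_num) hB hc hBt, sq, strSign_mul_self, one_mul]

end PauliStrings

end OTOC

end Literature.Computability.QuantumComplexity
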